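import Summits.BirchSwinnertonDyer.BirchSwinnertonDyer.Theorems.AdditiveKolyvaginRoadManinFrameResidueProperRTameTwistCharacter
import Summits.BirchSwinnertonDyer.BirchSwinnertonDyer.Theorems.AdditiveKolyvaginRoadManinFrameResidueProperRTameTwistSplit
import Literature.NumberTheory.EllipticCurves.ModularSymbolsLattice
import Literature.NumberTheory.EllipticCurves.PAdicLFunctionDistributionProofs
import HarnessLib

/-!
# Route `AdditiveKolyvaginRoad`, crux `ManinFrameResidueProperR` (stmt-BirchSwinnertonDyer-20709), line
# `birth`, stub TDS (`p ≥ 11`): the TAME-TWIST lever, part 2 — `Im {∞, γ∞}_f ∈ ℤ_(p)·|Ω⁻(W)|` for EVERY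
# `γ ∈ Γ₀(N)`, GRANTED the all-characters Kato–Kosters–Pannekoek fact, on the locus (A²) — `--supports`

Cell `pub/bsd-wall`, seat `bsd-wall-manin-p1` g3. THEOREMS ONLY (the Literature fact `kato_neron_isIntegral_twistedSymbolSum_of_additive`
is a hypothesis). No `sorry`; nothing is closed.

* `two_mul_sum_odd_twistedSymbolSum`: odd orthogonality applied to the twisted symbol sums —
  `2 Σ_{χ odd} χ(b)⁻¹ Σ_a χ(a){∞, a/d′}_f = (d′ − 1)({∞, b/d′}_f − conj {∞, b/d′}_f)` (prime `d′`,
  `gcd(b, d′) = 1`, real coefficients; tree `modularSymbol_add_intCast_holds`, `modularSymbol_neg_eq_conj_holds`).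
* `pint_im_cuspSymbol_of_adjustable`: for `γ = (a b; c d)` ADJUSTABLE (`c ≠ 0`, `d ≢ 1 (mod p)`,
  `d ≢ 1 (mod r)` for odd primes `r ∣ p − 1` dividing `c`): `{∞, γ∞}_f = {∞, b′/d′}_f − {∞, 0}_f` with
  `d′ = d + kc` the prime of `…RTameTwistGamma0` (Manin, `modularSymbol_gamma0_smul_holds` at `γT^k`), so
  `Im {∞, γ∞}_f / |Ω⁻(W)|` is `p`-integral by the identity above and `pint_twistedSymbolSum_div`.
* `pint_im_cuspSymbol`: every `γ` — `γ⁴ = γ₁ γ₂` adjustable (`…RTameTwistSplit`), `{∞, ·∞}_f` a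
  homomorphism (`cuspSymbol_mul_holds`), `p ∤ 4`.
-/

set_option autoImplicit false
set_option linter.dupNamespace false

noncomputable section

open scoped Classical MatrixGroups

open WeierstrassCurve NumberField Literature.NumberTheory.EllipticCurves
  Literature.NumberTheory.EllipticCurves.ModularForms
  Literature.NumberTheory.EllipticCurves.Rank1Residual
  Literature.NumberTheory.DiophantineGeometry IsDedekindDomain Rat.HeightOneSpectrum
  Summit.BirchSwinnertonDyer.Rank1Residual Summit.BirchSwinnertonDyer.Rank1Residual.Additive
  CongruenceSubgroup Complex

namespace Summit.BirchSwinnertonDyer.BirchSwinnertonDyer.Theorems.ManinFrameResidueProperRTameTwist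

/-! ### §3 One adjustable `γ`, then every `γ`: `Im {∞, γ∞}_f ∈ ℤ_(p) · |Ω⁻(W)|` -/

section Symbols

variable {W : WeierstrassCurve ℚ} [W.IsElliptic] [W.IsGloballyMinimal] {N : ℕ} [NeZero N]
  {p : ℕ} [hp : Fact p.Prime]

/-- Values of a Dirichlet character modulo a prime are algebraic integers (roots of unity or `0`).
[folklore] -/
theorem isIntegral_apply {d' : ℕ} (hd' : d'.Prime) (χ : DirichletCharacter ℂ d') (x : ZMod d') :
    IsIntegral ℤ (χ x) := by
  haveI : NeZero d' := ⟨hd'.ne_zero⟩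
  haveI : Fact d'.Prime := ⟨hd'⟩
  by_cases hx : x = 0
  · by_cases hu : IsUnit x
    · exact absurd hx hu.ne_zero
    · rw [χ.map_nonunit hu]; exact isIntegral_zero
  · exact isIntegral_of_pow_eq_one (Nat.sub_pos_of_lt hd'.one_lt)
      (by rw [← map_pow, ZMod.pow_card_sub_one_eq_one hx, map_one])

/-- **Odd orthogonality applied to the twisted symbol sums**: for a prime `d′`, `b ∈ ℤ` prime to `d′`,
and `f` with real coefficients,
`2 · Σ_{χ odd} χ(b)⁻¹ · Σ_a χ(a){∞, a/d′}_f = (d′ − 1) · ({∞, b/d′}_f − conj {∞, b/d′}_f)`.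
[cite: MazurTateTeitelbaum1986, §I.8] -/
theorem two_mul_sum_odd_twistedSymbolSum {d' : ℕ} (hd' : d'.Prime) (f : CuspForm (Gamma0 N) 2)
    (hreal : ∀ n, (cuspCoeff f n).im = 0) (b : ℤ) (hb : IsUnit ((b : ZMod d'))) :
    haveI : NeZero d' := ⟨hd'.ne_zero⟩
    2 * ∑ χ ∈ (Finset.univ : Finset (DirichletCharacter ℂ d')) with χ.Odd,
        χ ((b : ZMod d'))⁻¹ * twistedSymbolSum f χ =
      ((d' - 1 : ℕ) : ℂ) * (modularSymbol f ((b : ℚ) / d') -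
        starRingEnd ℂ (modularSymbol f ((b : ℚ) / d'))) := by
  haveI : NeZero d' := ⟨hd'.ne_zero⟩
  -- swap the sums and apply odd orthogonality
  have hswap : ∑ χ ∈ (Finset.univ : Finset (DirichletCharacter ℂ d')) with χ.Odd,
      χ ((b : ZMod d'))⁻¹ * twistedSymbolSum f χ =
      ∑ x : ZMod d', (∑ χ ∈ (Finset.univ : Finset (DirichletCharacter ℂ d')) with χ.Odd,
        χ ((b : ZMod d'))⁻¹ * χ x) * modularSymbol f ((x.val : ℚ) / d') := by
    simp only [twistedSymbolSum, Finset.mul_sum, Finset.sum_mul, mul_assoc]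
    exact Finset.sum_comm
  rw [hswap, Finset.mul_sum]
  simp_rw [← mul_assoc, two_mul_sum_odd_char_inv_mul_char _ hb, sub_mul, Finset.sum_sub_distrib,
    ite_mul, zero_mul, Finset.sum_ite_eq, Finset.mem_univ, if_true]
  have hneg : ∑ x : ZMod d', (if (b : ZMod d') = -x then
      (d'.totient : ℂ) * modularSymbol f ((x.val : ℚ) / d') else 0) =
      (d'.totient : ℂ) * modularSymbol f ((((-b : ℤ) : ZMod d').val : ℚ) / d') := by
    have : ∀ x : ZMod d', ((b : ZMod d') = -x) = (((-b : ℤ) : ZMod d') = x) := by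
      intro x; rw [Int.cast_neg, neg_eq_iff_eq_neg]
    simp_rw [this, Finset.sum_ite_eq, Finset.mem_univ, if_true]
  rw [hneg, Nat.totient_prime hd']
  -- the representatives `val` differ from `±b` by integers
  have hval : ∀ c : ℤ, modularSymbol f ((((c : ZMod d').val : ℕ) : ℚ) / d') = modularSymbol f ((c : ℚ) / d') := by
    intro c
    have h1 : (((c : ZMod d').val : ℕ) : ℤ) = c % d' := ZMod.val_intCast c
    have hd0 : (d' : ℚ) ≠ 0 := by exact_mod_cast hd'.ne_zero
    have h2 : ((((c : ZMod d').val : ℕ) : ℚ) / d') = (c : ℚ) / d' + ((-(c / d') : ℤ) : ℚ) := by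
      have h3 : ((((c : ZMod d').val : ℕ) : ℤ) : ℚ) = ((c % d' : ℤ) : ℚ) := by exact_mod_cast h1
      rw [Int.emod_def] at h3
      push_cast at h3 ⊢
      rw [h3]
      field_simp
      ring
    rw [h2, modularSymbol_add_intCast_holds f]
  rw [hval b, hval (-b), Int.cast_neg, neg_div, modularSymbol_neg_eq_conj_holds f hreal]
  ring

/-- **One adjustable `γ`.** Under the hypotheses of `pint_twistedSymbolSum_div` (fact, `p > 7` additive,
`Irr`, `p² ∣ N`, (A²)), for `γ = (a b; c d) ∈ Γ₀(N)` ADJUSTABLE (`c ≠ 0`, `d ≢ 1 (mod p)`, `d ≢ 1 (mod r)`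
for odd primes `r ∣ p − 1` dividing `c`): `Im {∞, γ∞}_f / |Ω⁻(W)|` is `p`-integral. [cite: Manin1972, Prop. 1.4 / Thm. 1.6]
[cite: Kato2004Asterisque, Thm. 9.7 (p. 189)] -/
theorem pint_im_cuspSymbol_of_adjustable (hK : kato_neron_isIntegral_twistedSymbolSum_of_additive)
    (hp7 : 7 < p) (hadd : Addv W p) (hirr : Irr W p) (f : CuspForm (Gamma0 N) 2) (hf : IsNewformOf W f)
    (hpN : p ^ 2 ∣ N)
    (hA : ∀ ℓ ∈ N.primeFactors, ¬ ℓ ^ 2 ∣ N →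
      ∀ j : ℕ, ((ℓ : ZMod p) / (W.LFunction ℓ : ZMod p)) ^ 2 ^ j ≠ 1)
    {ϖ : ℚ} (hϖ : (ϖ : ℝ) * W.imaginaryPeriodRat = minusPeriod f)
    (γ : Gamma0 N) (hc : (γ : SL(2, ℤ)) 1 0 ≠ 0) (hdp : ¬ (p : ℤ) ∣ (γ : SL(2, ℤ)) 1 1 - 1)
    (hdr : ∀ r : ℕ, r.Prime → r ≠ 2 → r ∣ p - 1 → (r : ℤ) ∣ (γ : SL(2, ℤ)) 1 0 →
      ¬ (r : ℤ) ∣ (γ : SL(2, ℤ)) 1 1 - 1) :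
    ∃ s : ℕ, ¬ p ∣ s ∧ IsIntegral ℤ ((s : ℂ) *
      ((((cuspSymbol f γ).im : ℝ) : ℂ) / (W.imaginaryPeriodRat : ℂ))) := by
  have hpP : p.Prime := hp.out
  have hpN1 : p ∣ N := (dvd_pow_self p two_ne_zero).trans hpN
  have hreal : ∀ n, (cuspCoeff f n).im = 0 := cuspCoeff_im_eq_zero_of_coeffField_eq_bot hf.coeffField_eq_bot
  obtain ⟨k, d', hd', hNd', hd'eq, hpd', hrd'⟩ :=
    exists_prime_eq_add_mul_of_adjustable hpP hpN1 γ hc hdp hdr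
  haveI : NeZero d' := ⟨hd'.ne_zero⟩
  -- `δ = γ T^k`: same first column, lower-right entry `d′`
  set δ : Gamma0 N := γ * ⟨ModularGroup.T ^ k, Literature.NumberTheory.Automorphic.T_zpow_mem_Gamma0 k⟩
    with hδdef
  obtain ⟨h00, h10, h01, h11⟩ := entries_mul_T_zpow (γ : SL(2, ℤ)) k
  have hδ : (δ : SL(2, ℤ)) = (γ : SL(2, ℤ)) * ModularGroup.T ^ k := rfl
  have hd11 : ((δ : SL(2, ℤ)) 1 1 : ℤ) = d' := by rw [hδ, h11, hd'eq]; ring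
  have hcs : cuspSymbol f δ = cuspSymbol f γ := by
    simp only [cuspSymbol, hδ, h00, h10]
  obtain ⟨b', hb'def⟩ : ∃ b' : ℤ, b' = (δ : SL(2, ℤ)) 0 1 := ⟨_, rfl⟩
  -- Manin: `{∞, b′/d′} = {∞, δ∞} + {∞, 0}`
  have hne : (((δ : SL(2, ℤ)) 1 0 : ℤ) : ℚ) * 0 + (((δ : SL(2, ℤ)) 1 1 : ℤ) : ℚ) ≠ 0 := by
    rw [mul_zero, zero_add, hd11]; exact_mod_cast hd'.ne_zero
  have hM := modularSymbol_gamma0_smul_holds f δ 0 hne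
  rw [mul_zero, zero_add, mul_zero, zero_add, hd11, hcs, ← hb'def, Int.cast_natCast] at hM
  -- `b′` is a unit mod `d′`
  have hbu : IsUnit ((b' : ZMod d')) := by
    rw [ZMod.coe_int_isUnit_iff_isCoprime]
    refine ⟨(δ : SL(2, ℤ)) 0 0, -(δ : SL(2, ℤ)) 1 0, ?_⟩
    have hdet := entry_det δ
    rw [hd11, ← hb'def] at hdet
    linear_combination hdet
  -- the odd-character identity, divided by `|Ω⁻| i`
  have hid := two_mul_sum_odd_twistedSymbolSum hd' f hreal b' hbu
  rw [hM, Complex.sub_conj] at hid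
  -- each summand divided by `Ω i` is `p`-integral
  have hΩ : 0 < W.imaginaryPeriodRat := W.imaginaryPeriodRat_pos
  have hΩ0 : (W.imaginaryPeriodRat : ℂ) ≠ 0 := by exact_mod_cast hΩ.ne'
  have hsum : ∃ s : ℕ, ¬ p ∣ s ∧ IsIntegral ℤ ((s : ℂ) *
      ∑ χ ∈ (Finset.univ : Finset (DirichletCharacter ℂ d')) with χ.Odd,
        χ ((b' : ZMod d'))⁻¹ * (twistedSymbolSum f χ / ((W.imaginaryPeriodRat : ℂ) * I))) := by
    refine pint_sum hpP _ _ fun χ hχ ↦ pint_mul hpP (pint_of_isIntegral hpP (isIntegral_apply hd' χ _)) ?_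
    exact pint_twistedSymbolSum_div hK hp7 hadd hirr f hf hpN hA hd' hNd' hpd' hrd' hϖ χ
      (Finset.mem_filter.mp hχ).2
  -- rewrite the sum as `(d′−1) · Im/Ω`
  have hsum_eq : ∑ χ ∈ (Finset.univ : Finset (DirichletCharacter ℂ d')) with χ.Odd,
      χ ((b' : ZMod d'))⁻¹ * (twistedSymbolSum f χ / ((W.imaginaryPeriodRat : ℂ) * I)) =
      ((d' - 1 : ℕ) : ℂ) * ((((cuspSymbol f γ + modularSymbol f 0).im : ℝ) : ℂ) /
        (W.imaginaryPeriodRat : ℂ)) := by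
    have h2 : (2 : ℂ) ≠ 0 := two_ne_zero
    simp_rw [← mul_div_assoc, ← Finset.sum_div]
    rw [show ∑ χ ∈ (Finset.univ : Finset (DirichletCharacter ℂ d')) with χ.Odd,
        χ ((b' : ZMod d'))⁻¹ * twistedSymbolSum f χ =
        ((d' - 1 : ℕ) : ℂ) * ((2 * (cuspSymbol f γ + modularSymbol f 0).im : ℝ) : ℂ) * I / 2 by
      rw [eq_div_iff h2, mul_comm _ (2 : ℂ), hid]; ring]
    push_cast
    field_simp
  rw [hsum_eq] at hsum
  have him0 : (modularSymbol f 0).im = 0 := by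
    have := modularSymbol_neg_eq_conj_holds f hreal 0
    rw [neg_zero] at this
    exact Complex.conj_eq_iff_im.mp this.symm
  rw [Complex.add_im, him0, add_zero] at hsum
  exact pint_of_pint_natCast_mul hpP hpd' hsum

/-- **Every `γ ∈ Γ₀(N)`**: `Im {∞, γ∞}_f / |Ω⁻(W)|` is `p`-integral — `γ⁴ = γ₁ γ₂` with adjustable
`γᵢ` (`…RTameTwistSplit`), `{∞, ·∞}_f` is a homomorphism (`cuspSymbol_mul_holds`), and `p ∤ 4`.
[cite: Manin1972, Prop. 1.4 / Thm. 1.6] -/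
theorem pint_im_cuspSymbol (hK : kato_neron_isIntegral_twistedSymbolSum_of_additive)
    (hp7 : 7 < p) (hadd : Addv W p) (hirr : Irr W p) (f : CuspForm (Gamma0 N) 2) (hf : IsNewformOf W f)
    (hpN : p ^ 2 ∣ N)
    (hA : ∀ ℓ ∈ N.primeFactors, ¬ ℓ ^ 2 ∣ N →
      ∀ j : ℕ, ((ℓ : ZMod p) / (W.LFunction ℓ : ZMod p)) ^ 2 ^ j ≠ 1)
    {ϖ : ℚ} (hϖ : (ϖ : ℝ) * W.imaginaryPeriodRat = minusPeriod f) (γ : Gamma0 N) :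
    ∃ s : ℕ, ¬ p ∣ s ∧ IsIntegral ℤ ((s : ℂ) *
      ((((cuspSymbol f γ).im : ℝ) : ℂ) / (W.imaginaryPeriodRat : ℂ))) := by
  have hpP : p.Prime := hp.out
  have hp5 : 5 ≤ p := by omega
  have hp4 : ¬ p ∣ 4 := fun h ↦ by have := Nat.le_of_dvd four_pos h; omega
  have hpN1 : p ∣ N := (dvd_pow_self p two_ne_zero).trans hpN
  -- `{∞, γ⁴∞} = 4 {∞, γ∞}`
  have h4 : cuspSymbol f (γ ^ 4) = 4 * cuspSymbol f γ := by
    have := map_pow (cuspSymbolHom f) γ 4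
    simp only [cuspSymbolHom_apply] at this
    have h := congrArg Multiplicative.toAdd this
    rw [toAdd_ofAdd, toAdd_pow, toAdd_ofAdd, nsmul_eq_mul, Nat.cast_ofNat] at h
    exact h
  have hcoe : ((γ ^ 4 : Gamma0 N) : SL(2, ℤ)) = (γ : SL(2, ℤ)) ^ 4 := rfl
  by_cases hc4 : ((γ ^ 4 : Gamma0 N) : SL(2, ℤ)) 1 0 = 0
  · -- `c(γ⁴) = 0`: the symbol vanishes
    have h0 : cuspSymbol f (γ ^ 4) = 0 := by simp only [cuspSymbol, hc4, if_true]
    rw [h4] at h0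
    have : cuspSymbol f γ = 0 := by
      rcases mul_eq_zero.mp h0 with h | h
      · norm_num at h
      · exact h
    rw [this, Complex.zero_im, Complex.ofReal_zero, zero_div]
    exact pint_of_isIntegral hpP isIntegral_zero
  · have h3 : 3 ∣ p - 1 → (3 : ℤ) ∣ ((γ ^ 4 : Gamma0 N) : SL(2, ℤ)) 1 0 →
        (3 : ℤ) ∣ ((γ ^ 4 : Gamma0 N) : SL(2, ℤ)) 1 1 - 1 := fun _ h ↦ by
      rw [hcoe] at h ⊢; exact three_dvd_pow_four_entry _ h
    obtain ⟨γ₁, γ₂, hmul, ⟨hc₁, hd₁, hr₁⟩, ⟨hc₂, hd₂, hr₂⟩⟩ :=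
      exists_eq_mul_adjustable hpP hp5 hpN1 (γ ^ 4) hc4 h3
    have hP₁ := pint_im_cuspSymbol_of_adjustable hK hp7 hadd hirr f hf hpN hA hϖ γ₁ hc₁ hd₁ hr₁
    have hP₂ := pint_im_cuspSymbol_of_adjustable hK hp7 hadd hirr f hf hpN hA hϖ γ₂ hc₂ hd₂ hr₂
    have hsum : cuspSymbol f γ₁ + cuspSymbol f γ₂ = 4 * cuspSymbol f γ := by
      rw [← h4, hmul, cuspSymbol_mul_holds f]
    have him : (((cuspSymbol f γ₁).im : ℝ) : ℂ) / (W.imaginaryPeriodRat : ℂ) +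
        (((cuspSymbol f γ₂).im : ℝ) : ℂ) / (W.imaginaryPeriodRat : ℂ) =
        ((4 : ℕ) : ℂ) * ((((cuspSymbol f γ).im : ℝ) : ℂ) / (W.imaginaryPeriodRat : ℂ)) := by
      have := congrArg Complex.im hsum
      rw [Complex.add_im] at this
      rw [← add_div, ← Complex.ofReal_add, this]
      simp [Complex.mul_im]
      ring
    refine pint_of_pint_natCast_mul hpP hp4 ?_
    rw [← him]
    exact pint_add hpP hP₁ hP₂

end Symbols

end Summit.BirchSwinnertonDyer.BirchSwinnertonDyer.Theorems.ManinFrameResidueProperRTameTwist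

end
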